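import Summits.AtomisticToContinuum.HydrodynamicLimit.Theorems.LambertianContactSwapLambertianEulerMarkov
import Literature.MathematicalPhysics.KineticTheory.LambertianRedrawNondegenerate
import Literature.MathematicalPhysics.KineticTheory.HardSphereEuler
import HarnessLib

/-!
# Optional stopping over the collision index of the Lambertian flow (time ledger, part II)

Helper file (`--supports`) of the crux `LambertianEuler` of route `LambertianContactSwap`
(`AtomisticToContinuum/HydrodynamicLimit`, stmt-AtomisticToContinuum-11854), line `Sketch`,
sub-goal `timeLedgerLambda` (rung (T) of the tails memo, stub `stub_tailsLambda`), whose content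
is the re-indexing BY TIME of a ledger known along the COLLISION INDEX of the Lambertian flow
`Λ_t = S_{t - t_K} z_K`, `K = K_t = lambertCount`, `z_m = lambertStateAfter`, `t_m = lambertInstant`
(`Literature.MathematicalPhysics.KineticTheory.LambertianHardSphereFlow`).

* Counting off the Zeno set (`lt_lambertCount_of_instant_succ_le`,
  `instant_succ_le_of_lt_lambertCount`, `ofReal_lt_instant_succ_iff`, `lambertCount_mono_of_le`):
  if the instants pass beyond `u`, then `m < K_u ↔ t_{m+1} ≤ u`, `u < t_{m+1} ↔ K_u ≤ m`, and the
  count is monotone in time (from `lambertSegment_of_count_eq` of `…LambertianEulerMarkov`).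
* `integral_flow_le_of_windowed_ledger` (any dimension) and its registered form
  `lambert_integral_flow_le_of_windowed_ledger` on `𝕋³` — **optional stopping**: for a functional
  `M ≥ 0` of the state kept by free flight and a functional `I`, both dominated along the
  recursion by an envelope `B` with `(K_{s'} + 1) B` integrable under `P ⊗ γ^ℕ`, the windowed
  ledgers `E[1_{A_m} M(z_{m+1})] ≤ E[1_{A_m} (M(z_m) + I(z_m))]` on the window events
  `A_m = {s < t_{m+1} ≤ s'}` sum, by telescoping and dominated convergence in the number of
  summands, to `E[M(Λ_{s'})] ≤ E[M(Λ_s)] + E[∑_{m<K_{s'}} 1_{s<t_{m+1}} I(z_m)]` whenever the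
  instants a.s. pass beyond `s'` (part I, `…TimeLedgerFresh`, supplies the windowed ledgers from a
  one-step conditional bound; part III, `…TimeLedger`, instantiates both with the `2k`-th velocity
  moment and the pair-Povzner increment).

All [folklore]; no definitions, no named facts.
-/

noncomputable section

open scoped BigOperators Topology ENNReal InnerProductSpace
open MeasureTheory ProbabilityTheory Filter Set
open Literature.MathematicalPhysics.KineticTheory
open Literature.Analysis.FluidPDE Literature.Analysis.FluidPDE.Alexander

namespace Summit.AtomisticToContinuum.HydrodynamicLimit.Theorems.LambertianContactSwapLambertianEulerTimeLedgerStopping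

open Summit.AtomisticToContinuum.HydrodynamicLimit.Theorems.LambertianContactSwapLambertianEulerMarkov

/-! ## Counting collisions off the Zeno set -/

section Count

variable {d : Type*} [Fintype d] {X : Type*} {N : ℕ} {G : Geometry d X} {ε : ℝ}
  {ξs : ℕ → EuclideanSpace ℝ d} {z : Config N d X}

/-- If the instants pass beyond `u`, a collision whose instant is at most `u` is counted:
`t_{m+1} ≤ u → m < K_u`. [folklore] -/
theorem lt_lambertCount_of_instant_succ_le {u : ℝ} {m : ℕ}
    (hex : ∃ k, ENNReal.ofReal u < lambertInstant G ε ξs z k)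
    (hm : lambertInstant G ε ξs z (m + 1) ≤ ENNReal.ofReal u) : m < lambertCount G ε ξs z u := by
  by_contra h
  have h2 := (lambertSegment_of_count_eq hex rfl).2
  exact (not_le.2 h2) ((monotone_lambertInstant ξs z (Nat.succ_le_succ (not_lt.1 h))).trans hm)

/-- If the instants pass beyond `u`, the counted collisions happened by time `u`:
`m < K_u → t_{m+1} ≤ u`. [folklore] -/
theorem instant_succ_le_of_lt_lambertCount {u : ℝ} {m : ℕ}
    (hex : ∃ k, ENNReal.ofReal u < lambertInstant G ε ξs z k) (hm : m < lambertCount G ε ξs z u) :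
    lambertInstant G ε ξs z (m + 1) ≤ ENNReal.ofReal u :=
  (monotone_lambertInstant ξs z (Nat.succ_le_of_lt hm)).trans (lambertSegment_of_count_eq hex rfl).1

/-- If the instants pass beyond `u`: `u < t_{m+1} ↔ K_u ≤ m`. [folklore] -/
theorem ofReal_lt_instant_succ_iff {u : ℝ} {m : ℕ}
    (hex : ∃ k, ENNReal.ofReal u < lambertInstant G ε ξs z k) :
    ENNReal.ofReal u < lambertInstant G ε ξs z (m + 1) ↔ lambertCount G ε ξs z u ≤ m := by
  constructor
  · intro h
    by_contra hlt
    exact (not_le.2 h) (instant_succ_le_of_lt_lambertCount hex (not_le.1 hlt))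
  · intro h
    exact (lambertSegment_of_count_eq hex rfl).2.trans_le
      (monotone_lambertInstant ξs z (Nat.succ_le_succ h))

/-- If the instants pass beyond `u'`, the count is monotone up to `u'`: `u ≤ u' → K_u ≤ K_{u'}`.
[folklore] -/
theorem lambertCount_mono_of_le {u u' : ℝ}
    (hex : ∃ k, ENNReal.ofReal u' < lambertInstant G ε ξs z k) (h : u ≤ u') :
    lambertCount G ε ξs z u ≤ lambertCount G ε ξs z u' := by
  have hex' : ∃ k, ENNReal.ofReal u < lambertInstant G ε ξs z k :=
    hex.imp fun k hk => (ENNReal.ofReal_le_ofReal h).trans_lt hk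
  by_contra hlt
  have h1 := (lambertSegment_of_count_eq hex' rfl).1
  have h2 := (lambertSegment_of_count_eq hex rfl).2
  exact (not_le.2 h2) ((monotone_lambertInstant ξs z (Nat.succ_le_of_lt (not_le.1 hlt))).trans
    (h1.trans (ENNReal.ofReal_le_ofReal h)))

end Count

/-! ## Elementary summation lemmas -/

/-- Telescoping over a window: `∑_{m<b} 1_{a ≤ m} (f(m+1) - f(m)) = f(b) - f(a)` for `a ≤ b`.
[folklore] -/
theorem sum_range_ite_sub_eq (f : ℕ → ℝ) {a b : ℕ} (hab : a ≤ b) :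
    ∑ m ∈ Finset.range b, (if a ≤ m then f (m + 1) - f m else 0) = f b - f a := by
  induction b, hab using Nat.le_induction with
  | base =>
    rw [sub_self]
    exact Finset.sum_eq_zero fun m hm => if_neg (not_le.2 (Finset.mem_range.1 hm))
  | succ b hab ih => rw [Finset.sum_range_succ, ih, if_pos hab]; ring

/-- A sum of uniformly bounded terms vanishing from the index `K` on is at most `K` times the
bound, whatever the range. [folklore] -/
theorem abs_sum_range_le_of_eq_zero {g : ℕ → ℝ} {K : ℕ} {B : ℝ} (hg : ∀ m, |g m| ≤ B)
    (hg0 : ∀ m, K ≤ m → g m = 0) (n : ℕ) : |∑ m ∈ Finset.range n, g m| ≤ K * B := by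
  have hB : 0 ≤ B := (abs_nonneg _).trans (hg 0)
  have hK : ∑ m ∈ Finset.range K, |g m| ≤ K * B :=
    (Finset.sum_le_sum fun m _ => hg m).trans (by rw [Finset.sum_const, Finset.card_range,
      nsmul_eq_mul])
  refine (Finset.abs_sum_le_sum_abs _ _).trans (le_trans ?_ hK)
  rcases le_total n K with h | h
  · exact Finset.sum_le_sum_of_subset_of_nonneg (Finset.range_mono h) fun _ _ _ => abs_nonneg _
  · rw [Finset.eventually_constant_sum (fun m hm => by rw [hg0 m hm, abs_zero]) h]

/-! ## Optional stopping over the collision index -/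

section Abstract

variable {d : Type*} [Fintype d] {X : Type*} {N : ℕ} [TopologicalSpace X] [MeasurableSpace X]
  {G : Geometry d X} {ε : ℝ}

/-- **A windowed one-step ledger, summed over the collisions of a time window** (optional
stopping over the collision index; any dimension, regular measurable geometry, any initial law
`P`). Let `M ≥ 0` be a measurable functional of the state invariant under free flight, `I` a
measurable functional, both dominated along the recursion by an envelope `B` with `(K_{s'} + 1) B`
integrable under `P ⊗ γ^ℕ`. If for every collision index `m` the ledger holds in the mean ON THE
WINDOW EVENT `A_m = {s < t_{m+1} ≤ s'}`, `E[1_{A_m} M(z_{m+1})] ≤ E[1_{A_m} (M(z_m) + I(z_m))]`, and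
the instants a.s. pass beyond `s'`, then for `s ≤ s'`
`E[M(Λ_{s'})] ≤ E[M(Λ_s)] + E[∑_{m < K_{s'}} 1_{s < t_{m+1}} I(z_m)]`. Proof: `M(Λ_u) = M(z_{K_u})`
(free flight keeps `M`); off the Zeno set `A_m = {K_s ≤ m < K_{s'}}`, so the partial sums over
`m < n` of `1_{A_m} (M(z_{m+1}) - M(z_m))` telescope, for `n ≥ K_{s'}`, to `M(Λ_{s'}) - M(Λ_s)`, and
those of `1_{A_m} I(z_m)` to the stated sum; both are dominated by `2 (K_{s'} + 1) B`, and dominated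
convergence in `n` turns the summed windowed ledgers into the claim. [folklore] -/
theorem integral_flow_le_of_windowed_ledger (hG : G.IsHardSphereRegular ε) (hGm : G.IsMeasurable)
    (P : Measure (Config N d X)) {M I : Config N d X → ℝ} (hMm : Measurable M)
    (hIm : Measurable I) (hM0 : ∀ w, 0 ≤ M w)
    (hMfree : ∀ (t : ℝ) (w : Config N d X), M (freeFlight G t w) = M w)
    {B : Config N d X × (ℕ → EuclideanSpace ℝ d) → ℝ} (hBm : Measurable B)
    (hMB : ∀ (m : ℕ) (p : Config N d X × (ℕ → EuclideanSpace ℝ d)),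
      M (lambertStateAfter G ε p.2 p.1 m) ≤ B p)
    (hIB : ∀ (m : ℕ) (p : Config N d X × (ℕ → EuclideanSpace ℝ d)),
      |I (lambertStateAfter G ε p.2 p.1 m)| ≤ B p)
    {s s' : ℝ} (hss' : s ≤ s')
    (hInt : Integrable (fun p : Config N d X × (ℕ → EuclideanSpace ℝ d) =>
      ((lambertCount G ε p.2 p.1 s' : ℝ) + 1) * B p) (P.prod (lambertNoise d)))
    (hstepA : ∀ m : ℕ,
      ∫ p, {p : Config N d X × (ℕ → EuclideanSpace ℝ d) |
          ENNReal.ofReal s < lambertInstant G ε p.2 p.1 (m + 1) ∧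
            lambertInstant G ε p.2 p.1 (m + 1) ≤ ENNReal.ofReal s'}.indicator
          (fun p => M (lambertStateAfter G ε p.2 p.1 (m + 1))) p ∂(P.prod (lambertNoise d)) ≤
        ∫ p, {p : Config N d X × (ℕ → EuclideanSpace ℝ d) |
          ENNReal.ofReal s < lambertInstant G ε p.2 p.1 (m + 1) ∧
            lambertInstant G ε p.2 p.1 (m + 1) ≤ ENNReal.ofReal s'}.indicator
          (fun p => M (lambertStateAfter G ε p.2 p.1 m) + I (lambertStateAfter G ε p.2 p.1 m)) p
          ∂(P.prod (lambertNoise d)))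
    (hacc : ∀ᵐ p ∂(P.prod (lambertNoise d)),
      ∃ n, ENNReal.ofReal s' < lambertInstant G ε p.2 p.1 n) :
    ∫ p, M (lambertFlow G ε p.2 p.1 s') ∂(P.prod (lambertNoise d)) ≤
      ∫ p, M (lambertFlow G ε p.2 p.1 s) ∂(P.prod (lambertNoise d)) +
      ∫ p, (∑ m ∈ Finset.range (lambertCount G ε p.2 p.1 s'),
        if ENNReal.ofReal s < lambertInstant G ε p.2 p.1 (m + 1) then
          I (lambertStateAfter G ε p.2 p.1 m) else 0) ∂(P.prod (lambertNoise d)) := by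
  classical
  -- the window events `A m = {s < t_{m+1} ≤ s'}`
  set A : ℕ → Set (Config N d X × (ℕ → EuclideanSpace ℝ d)) := fun m =>
    {p | ENNReal.ofReal s < lambertInstant G ε p.2 p.1 (m + 1) ∧
      lambertInstant G ε p.2 p.1 (m + 1) ≤ ENNReal.ofReal s'} with hAdef
  -- measurability
  have hZ : ∀ m, Measurable fun p : Config N d X × (ℕ → EuclideanSpace ℝ d) =>
      lambertStateAfter G ε p.2 p.1 m := fun m => measurable_lambertStateAfter hG hGm m
  have hT : ∀ m, Measurable fun p : Config N d X × (ℕ → EuclideanSpace ℝ d) =>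
      lambertInstant G ε p.2 p.1 m := fun m => measurable_lambertInstant hG hGm m
  have hA : ∀ m, MeasurableSet (A m) := fun m =>
    (measurableSet_lt measurable_const (hT (m + 1))).inter
      (measurableSet_le (hT (m + 1)) measurable_const)
  -- integrability along the recursion
  have hB0 : ∀ p, 0 ≤ B p := fun p => (hM0 _).trans (hMB 0 p)
  have hBint : Integrable B (P.prod (lambertNoise d)) := by
    refine hInt.mono' hBm.aestronglyMeasurable (Eventually.of_forall fun p => ?_)
    rw [Real.norm_of_nonneg (hB0 p)]
    exact le_mul_of_one_le_left (hB0 p) (le_add_of_nonneg_left (Nat.cast_nonneg _))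
  have hintM : ∀ m, Integrable (fun p : Config N d X × (ℕ → EuclideanSpace ℝ d) =>
      M (lambertStateAfter G ε p.2 p.1 m)) (P.prod (lambertNoise d)) := fun m =>
    hBint.mono' (hMm.comp (hZ m)).aestronglyMeasurable (Eventually.of_forall fun p => by
      rw [Real.norm_of_nonneg (hM0 _)]; exact hMB m p)
  have hintI : ∀ m, Integrable (fun p : Config N d X × (ℕ → EuclideanSpace ℝ d) =>
      I (lambertStateAfter G ε p.2 p.1 m)) (P.prod (lambertNoise d)) := fun m =>
    hBint.mono' (hIm.comp (hZ m)).aestronglyMeasurable (Eventually.of_forall fun p => by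
      rw [Real.norm_eq_abs]; exact hIB m p)
  -- `M` along the flow is `M` at the last post-collisional state
  have hflow : ∀ (t : ℝ) (p : Config N d X × (ℕ → EuclideanSpace ℝ d)),
      M (lambertFlow G ε p.2 p.1 t) =
        M (lambertStateAfter G ε p.2 p.1 (lambertCount G ε p.2 p.1 t)) :=
    fun t p => hMfree _ _
  have hintΛ : ∀ t : ℝ, Integrable (fun p : Config N d X × (ℕ → EuclideanSpace ℝ d) =>
      M (lambertFlow G ε p.2 p.1 t)) (P.prod (lambertNoise d)) := fun t =>
    hBint.mono' (hMm.comp (measurable_lambertFlow hG hGm t)).aestronglyMeasurable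
      (Eventually.of_forall fun p => by rw [Real.norm_of_nonneg (hM0 _), hflow]; exact hMB _ p)
  -- the windowed one-step ledger, for each collision index
  have hstepD : ∀ m, ∫ p, (A m).indicator (fun p => M (lambertStateAfter G ε p.2 p.1 (m + 1)) -
      M (lambertStateAfter G ε p.2 p.1 m)) p ∂(P.prod (lambertNoise d)) ≤
        ∫ p, (A m).indicator (fun p => I (lambertStateAfter G ε p.2 p.1 m)) p
          ∂(P.prod (lambertNoise d)) := by
    intro m
    have h := hstepA m
    simp only [Set.indicator_add] at h
    rw [integral_add ((hintM m).indicator (hA m)) ((hintI m).indicator (hA m))] at h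
    simp only [Set.indicator_sub]
    rw [integral_sub ((hintM (m + 1)).indicator (hA m)) ((hintM m).indicator (hA m))]
    linarith
  -- partial sums
  have hsum : ∀ n : ℕ, ∫ p, (∑ m ∈ Finset.range n, (A m).indicator (fun p =>
      M (lambertStateAfter G ε p.2 p.1 (m + 1)) - M (lambertStateAfter G ε p.2 p.1 m)) p)
        ∂(P.prod (lambertNoise d)) ≤
      ∫ p, (∑ m ∈ Finset.range n, (A m).indicator (fun p =>
        I (lambertStateAfter G ε p.2 p.1 m)) p) ∂(P.prod (lambertNoise d)) := by
    intro n
    rw [integral_finsetSum _ fun m _ => ((hintM (m + 1)).sub' (hintM m)).indicator (hA m),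
      integral_finsetSum _ fun m _ => (hintI m).indicator (hA m)]
    exact Finset.sum_le_sum fun m _ => hstepD m
  -- pointwise bookkeeping off the Zeno set
  have hfacts : ∀ p : Config N d X × (ℕ → EuclideanSpace ℝ d),
      (∃ n, ENNReal.ofReal s' < lambertInstant G ε p.2 p.1 n) →
      (∀ m, lambertCount G ε p.2 p.1 s' ≤ m → p ∉ A m) ∧
      (∀ m, m < lambertCount G ε p.2 p.1 s' →
        (p ∈ A m ↔ ENNReal.ofReal s < lambertInstant G ε p.2 p.1 (m + 1))) ∧
      (∀ m, m < lambertCount G ε p.2 p.1 s' → (p ∈ A m ↔ lambertCount G ε p.2 p.1 s ≤ m)) ∧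
      lambertCount G ε p.2 p.1 s ≤ lambertCount G ε p.2 p.1 s' := by
    intro p hp
    have hexs : ∃ n, ENNReal.ofReal s < lambertInstant G ε p.2 p.1 n :=
      hp.imp fun n hn => (ENNReal.ofReal_le_ofReal hss').trans_lt hn
    have h2 : ∀ m, m < lambertCount G ε p.2 p.1 s' →
        (p ∈ A m ↔ ENNReal.ofReal s < lambertInstant G ε p.2 p.1 (m + 1)) := fun m hm =>
      ⟨fun h => h.1, fun h => ⟨h, instant_succ_le_of_lt_lambertCount hp hm⟩⟩
    exact ⟨fun m hm hpA => (not_le.2 (lt_lambertCount_of_instant_succ_le hp hpA.2)) hm, h2,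
      fun m hm => (h2 m hm).trans (ofReal_lt_instant_succ_iff hexs),
      lambertCount_mono_of_le hp hss'⟩
  -- dominated convergence: the moments
  have hlimL : Tendsto (fun n => ∫ p, (∑ m ∈ Finset.range n, (A m).indicator (fun p =>
      M (lambertStateAfter G ε p.2 p.1 (m + 1)) - M (lambertStateAfter G ε p.2 p.1 m)) p)
        ∂(P.prod (lambertNoise d))) atTop
      (𝓝 (∫ p, (M (lambertFlow G ε p.2 p.1 s') - M (lambertFlow G ε p.2 p.1 s))
        ∂(P.prod (lambertNoise d)))) := by
    refine tendsto_integral_of_dominated_convergence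
      (fun p => 2 * (((lambertCount G ε p.2 p.1 s' : ℝ) + 1) * B p))
      (fun n => (Finset.measurable_sum _ fun m _ =>
        (((hMm.comp (hZ (m + 1))).sub (hMm.comp (hZ m))).indicator (hA m))).aestronglyMeasurable)
      (hInt.const_mul 2) (fun n => ?_) ?_
    · filter_upwards [hacc] with p hp
      obtain ⟨hnotA, -, -, -⟩ := hfacts p hp
      rw [Real.norm_eq_abs]
      refine (abs_sum_range_le_of_eq_zero (K := lambertCount G ε p.2 p.1 s') (B := 2 * B p)
        (fun m => ?_) (fun m hm => Set.indicator_of_notMem (hnotA m hm) _) n).trans ?_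
      · calc |(A m).indicator (fun p => M (lambertStateAfter G ε p.2 p.1 (m + 1)) -
              M (lambertStateAfter G ε p.2 p.1 m)) p|
            ≤ |M (lambertStateAfter G ε p.2 p.1 (m + 1)) -
                M (lambertStateAfter G ε p.2 p.1 m)| := by
              simpa only [Real.norm_eq_abs] using norm_indicator_le_norm_self (fun p =>
                M (lambertStateAfter G ε p.2 p.1 (m + 1)) - M (lambertStateAfter G ε p.2 p.1 m)) p
          _ ≤ |M (lambertStateAfter G ε p.2 p.1 (m + 1))| + |M (lambertStateAfter G ε p.2 p.1 m)| :=
              abs_sub _ _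
          _ ≤ B p + B p := add_le_add (by rw [abs_of_nonneg (hM0 _)]; exact hMB _ p)
              (by rw [abs_of_nonneg (hM0 _)]; exact hMB _ p)
          _ = 2 * B p := by ring
      · nlinarith [hB0 p]
    · filter_upwards [hacc] with p hp
      obtain ⟨hnotA, -, hAiff, hKle⟩ := hfacts p hp
      refine tendsto_atTop_of_eventually_const (i₀ := lambertCount G ε p.2 p.1 s') fun n hn => ?_
      rw [Finset.eventually_constant_sum (fun m hm => Set.indicator_of_notMem (hnotA m hm) _) hn,
        hflow s', hflow s,
        ← sum_range_ite_sub_eq (fun j => M (lambertStateAfter G ε p.2 p.1 j)) hKle]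
      refine Finset.sum_congr rfl fun m hm => ?_
      have hm' := Finset.mem_range.1 hm
      by_cases hKm : lambertCount G ε p.2 p.1 s ≤ m
      · rw [if_pos hKm, Set.indicator_of_mem ((hAiff m hm').2 hKm)]
      · rw [if_neg hKm, Set.indicator_of_notMem (fun h => hKm ((hAiff m hm').1 h))]
  -- dominated convergence: the increments
  have hlimR : Tendsto (fun n => ∫ p, (∑ m ∈ Finset.range n, (A m).indicator (fun p =>
      I (lambertStateAfter G ε p.2 p.1 m)) p) ∂(P.prod (lambertNoise d))) atTop
      (𝓝 (∫ p, (∑ m ∈ Finset.range (lambertCount G ε p.2 p.1 s'),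
        if ENNReal.ofReal s < lambertInstant G ε p.2 p.1 (m + 1) then
          I (lambertStateAfter G ε p.2 p.1 m) else 0) ∂(P.prod (lambertNoise d)))) := by
    refine tendsto_integral_of_dominated_convergence
      (fun p => ((lambertCount G ε p.2 p.1 s' : ℝ) + 1) * B p)
      (fun n => (Finset.measurable_sum _ fun m _ =>
        ((hIm.comp (hZ m)).indicator (hA m))).aestronglyMeasurable)
      hInt (fun n => ?_) ?_
    · filter_upwards [hacc] with p hp
      obtain ⟨hnotA, -, -, -⟩ := hfacts p hp
      rw [Real.norm_eq_abs]
      refine (abs_sum_range_le_of_eq_zero (K := lambertCount G ε p.2 p.1 s') (B := B p)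
        (fun m => ?_) (fun m hm => Set.indicator_of_notMem (hnotA m hm) _) n).trans ?_
      · calc |(A m).indicator (fun p => I (lambertStateAfter G ε p.2 p.1 m)) p|
            ≤ |I (lambertStateAfter G ε p.2 p.1 m)| := by
              simpa only [Real.norm_eq_abs] using norm_indicator_le_norm_self (fun p =>
                I (lambertStateAfter G ε p.2 p.1 m)) p
          _ ≤ B p := hIB m p
      · nlinarith [hB0 p]
    · filter_upwards [hacc] with p hp
      obtain ⟨hnotA, hAiff, -, -⟩ := hfacts p hp
      refine tendsto_atTop_of_eventually_const (i₀ := lambertCount G ε p.2 p.1 s') fun n hn => ?_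
      rw [Finset.eventually_constant_sum (fun m hm => Set.indicator_of_notMem (hnotA m hm) _) hn]
      refine Finset.sum_congr rfl fun m hm => ?_
      have hm' := Finset.mem_range.1 hm
      by_cases hsm : ENNReal.ofReal s < lambertInstant G ε p.2 p.1 (m + 1)
      · rw [if_pos hsm, Set.indicator_of_mem ((hAiff m hm').2 hsm)]
      · rw [if_neg hsm, Set.indicator_of_notMem (fun h => hsm ((hAiff m hm').1 h))]
  -- conclusion
  have hle := le_of_tendsto_of_tendsto' hlimL hlimR hsum
  rw [integral_sub (hintΛ s') (hintΛ s)] at hle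
  linarith

end Abstract

/-! ## Registered form on `𝕋³` -/

/-- **Optional stopping over the collision index of the Lambertian flow on `𝕋³`** (registered
sub-goal `lambert_integral_flow_le_of_windowed_ledger` of `timeLedgerLambda`, line `Sketch`;
term-style statement): for a regular measurable geometry `G` on `𝕋³`, a law `P` of the datum,
measurable `M ≥ 0` kept by free flight, measurable `I`, a measurable envelope `B` of `M` and `|I|`
along the recursion with `(K_{s'} + 1) B` integrable under `P ⊗ γ^ℕ`, times `s ≤ s'`, the windowed
ledgers `E[1_{A_m} M(z_{m+1})] ≤ E[1_{A_m} (M(z_m) + I(z_m))]`, `A_m = {s < t_{m+1} ≤ s'}`, and a.s.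
non-accumulation of the instants before `s'` give
`E[M(Λ_{s'})] ≤ E[M(Λ_s)] + E[∑_{m<K_{s'}} 1_{s<t_{m+1}} I(z_m)]`. [folklore] -/
theorem lambert_integral_flow_le_of_windowed_ledger :
    ∀ {N : ℕ} {G : Geometry (Fin 3) T3} {ε : ℝ}, G.IsHardSphereRegular ε → G.IsMeasurable →
    ∀ (P : Measure (Config N (Fin 3) T3)) {M I : Config N (Fin 3) T3 → ℝ}, Measurable M →
      Measurable I → (∀ w, 0 ≤ M w) →
      (∀ (t : ℝ) (w : Config N (Fin 3) T3), M (freeFlight G t w) = M w) →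
    ∀ {B : Config N (Fin 3) T3 × (ℕ → V3) → ℝ}, Measurable B →
      (∀ (m : ℕ) (p : Config N (Fin 3) T3 × (ℕ → V3)),
        M (lambertStateAfter G ε p.2 p.1 m) ≤ B p) →
      (∀ (m : ℕ) (p : Config N (Fin 3) T3 × (ℕ → V3)),
        |I (lambertStateAfter G ε p.2 p.1 m)| ≤ B p) →
    ∀ {s s' : ℝ}, s ≤ s' →
      Integrable (fun p : Config N (Fin 3) T3 × (ℕ → V3) =>
        ((lambertCount G ε p.2 p.1 s' : ℝ) + 1) * B p) (P.prod (lambertNoise (Fin 3))) →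
      (∀ m : ℕ,
        ∫ p, {p : Config N (Fin 3) T3 × (ℕ → V3) |
            ENNReal.ofReal s < lambertInstant G ε p.2 p.1 (m + 1) ∧
              lambertInstant G ε p.2 p.1 (m + 1) ≤ ENNReal.ofReal s'}.indicator
            (fun p => M (lambertStateAfter G ε p.2 p.1 (m + 1))) p
            ∂(P.prod (lambertNoise (Fin 3))) ≤
          ∫ p, {p : Config N (Fin 3) T3 × (ℕ → V3) |
            ENNReal.ofReal s < lambertInstant G ε p.2 p.1 (m + 1) ∧
              lambertInstant G ε p.2 p.1 (m + 1) ≤ ENNReal.ofReal s'}.indicator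
            (fun p => M (lambertStateAfter G ε p.2 p.1 m) + I (lambertStateAfter G ε p.2 p.1 m)) p
            ∂(P.prod (lambertNoise (Fin 3)))) →
      (∀ᵐ p ∂(P.prod (lambertNoise (Fin 3))),
        ∃ n, ENNReal.ofReal s' < lambertInstant G ε p.2 p.1 n) →
      ∫ p, M (lambertFlow G ε p.2 p.1 s') ∂(P.prod (lambertNoise (Fin 3))) ≤
        ∫ p, M (lambertFlow G ε p.2 p.1 s) ∂(P.prod (lambertNoise (Fin 3))) +
        ∫ p, (∑ m ∈ Finset.range (lambertCount G ε p.2 p.1 s'),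
          if ENNReal.ofReal s < lambertInstant G ε p.2 p.1 (m + 1) then
            I (lambertStateAfter G ε p.2 p.1 m) else 0) ∂(P.prod (lambertNoise (Fin 3))) :=
  fun hG hGm P _ _ hMm hIm hM0 hMfree _ hBm hMB hIB _ _ hss' hInt hstepA hacc =>
    integral_flow_le_of_windowed_ledger hG hGm P hMm hIm hM0 hMfree hBm hMB hIB hss' hInt hstepA
      hacc

end Summit.AtomisticToContinuum.HydrodynamicLimit.Theorems.LambertianContactSwapLambertianEulerTimeLedgerStopping

end
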